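import Mathlib.NumberTheory.ArithmeticFunction.Moebius
import Mathlib.Analysis.Complex.Basic
import Literature.NumberTheory.LFunctions.AutomaticSequenceTransducer
import HarnessLib

/-!
# Final components of a finite automaton and the restriction to them (proved)

Everything in this file is PROVED (plus plain definitions). It supplies the graph-theoretic
vocabulary of C. Müllner, *Automatic sequences fulfill the Sarnak conjecture* (Duke Math. J. 166
(2017)), §1.1 and §3.1/§5.1, used in the reduction Prop. 3.3: "Let `Q'₁, …, Q'_ℓ` be the strongly
connected components of `Q'` that are closed under `δ'`" (the FINAL components), the fact that
every state reaches a final component (Lemma setDens, §5.1: "for each `q'₁ ∈ Q'` there exists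
`w_{q'₁}` such that `δ'(q'₁, w_{q'₁})` belongs to `Q'_i` for some `i`"), and the restriction
`A_i` of the automaton to a final component, which is strongly connected:

* `digitRestrict k δ` — the same automaton with non-digits acting trivially (so that "all words"
  and "digit words" agree; `dfaoSeq` is unchanged, `dfaoSeq_digitRestrict`);
* `reach δ q` — the states reachable from `q`; `finalStates δ` — the states `q` with
  `q ∈ reach(q')` for every `q' ∈ reach(q)` (= the union of the final components); it is closed
  (`finalStates_closed`) and reached from everywhere (`exists_wordAct_mem_finalStates`);
* `restrictδ C hC` — the automaton restricted to a closed set of states, `coe_wordAct_restrictδ`,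
  and `isStronglyConnected_restrict_reach`: the component `reach δ q` of a final state `q` is a
  strongly connected automaton;
* `TransducerMoebiusEstimate k δ M π λ₁ λ₂` — the PROPERTY asserted by Müllner's Prop. 3.2 (regular
  representation, shift `0`), the hypothesis of the reduction Prop. 3.3
  (`MoebiusAutomaticTransducerReduction.lean`); it is not asserted here.

## References
* C. Müllner, Duke Math. J. 166 (2017), §1.1 ("final component"), §3.1, §5.1. [Mullner2017]
-/

noncomputable section

open Finset

namespace Literature.NumberTheory.LFunctions

/-! ## Non-digits act trivially -/

section DigitRestrict

variable {σ : Type*}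

/-- The automaton with the letters `≥ k` acting trivially. [folklore] -/
def digitRestrict (k : ℕ) (δ : σ → ℕ → σ) : σ → ℕ → σ :=
  fun q d => if d < k then δ q d else q

/-- Digits act as before. [folklore] -/
theorem digitRestrict_of_lt {k : ℕ} (δ : σ → ℕ → σ) (q : σ) {d : ℕ} (hd : d < k) :
    digitRestrict k δ q d = δ q d := if_pos hd

/-- Non-digits act trivially. [folklore] -/
theorem digitRestrict_of_le {k : ℕ} (δ : σ → ℕ → σ) (q : σ) {d : ℕ} (hd : k ≤ d) :
    digitRestrict k δ q d = q := if_neg (not_lt.2 hd)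

/-- On digit words the restricted automaton acts as the original one. [folklore] -/
theorem wordAct_digitRestrict {k : ℕ} (δ : σ → ℕ → σ) {w : List ℕ} (hw : ∀ d ∈ w, d < k)
    (q : σ) : wordAct (digitRestrict k δ) w q = wordAct δ w q := by
  induction w generalizing q with
  | nil => rfl
  | cons d w ih =>
    rw [wordAct, wordAct, List.foldl_cons, List.foldl_cons, digitRestrict_of_lt δ q (hw d (by simp))]
    exact ih (fun x hx => hw x (List.mem_cons_of_mem _ hx)) _

/-- Any word acts on the restricted automaton as its subword of digits. [folklore] -/
theorem wordAct_digitRestrict_filter {k : ℕ} (δ : σ → ℕ → σ) (w : List ℕ) (q : σ) :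
    wordAct (digitRestrict k δ) w q = wordAct (digitRestrict k δ) (w.filter (· < k)) q := by
  induction w generalizing q with
  | nil => rfl
  | cons d w ih =>
    rw [wordAct, List.foldl_cons, List.filter_cons]
    by_cases hd : d < k
    · simp only [hd, decide_true, if_true]
      exact ih _
    · simp only [hd, decide_false]
      rw [digitRestrict_of_le δ q (not_lt.1 hd)]
      exact ih q

/-- If the letters `≥ k` act trivially, any word acts as its subword of digits. [folklore] -/
theorem wordAct_filter_of_trivial {k : ℕ} {δ : σ → ℕ → σ} (htriv : ∀ q d, k ≤ d → δ q d = q)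
    (w : List ℕ) (q : σ) : wordAct δ w q = wordAct δ (w.filter (· < k)) q := by
  induction w generalizing q with
  | nil => rfl
  | cons d w ih =>
    rw [wordAct, List.foldl_cons, List.filter_cons]
    by_cases hd : d < k
    · simp only [hd, decide_true, if_true]
      exact ih _
    · simp only [hd, decide_false]
      rw [htriv q d (not_lt.1 hd)]
      exact ih q

/-- `digitRestrict` makes the letters `≥ k` act trivially. [folklore] -/
theorem digitRestrict_trivial (k : ℕ) (δ : σ → ℕ → σ) :
    ∀ q d, k ≤ d → digitRestrict k δ q d = q := fun q _ hd => digitRestrict_of_le δ q hd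

/-- The letters of a filtered word are digits. [folklore] -/
theorem mem_filter_lt {k : ℕ} {w : List ℕ} {d : ℕ} (hd : d ∈ w.filter (· < k)) : d < k := by
  have := (List.mem_filter.1 hd).2
  simpa using this

/-- The generated sequence is unchanged. [folklore] -/
theorem dfaoSeq_digitRestrict {k : ℕ} (hk : 2 ≤ k) (δ : σ → ℕ → σ) (q₀ : σ) (τ : σ → ℂ) :
    dfaoSeq k (digitRestrict k δ) q₀ τ = dfaoSeq k δ q₀ τ := by
  funext n
  simp only [dfaoSeq]
  have : ∀ d ∈ (Nat.digits k n).reverse, d < k := fun d hd =>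
    Nat.digits_lt_base hk (List.mem_reverse.1 hd)
  exact congrArg τ (wordAct_digitRestrict δ this q₀)

end DigitRestrict

/-! ## Reachability and final states -/

section Reach

variable {σ : Type*} [Fintype σ]

/-- The states reachable from `q` (by arbitrary words). [folklore] -/
def reach (δ : σ → ℕ → σ) (q : σ) : Finset σ := by
  classical exact univ.filter fun q' => ∃ u : List ℕ, wordAct δ u q = q'

/-- Membership in `reach`. [folklore] -/
theorem mem_reach {δ : σ → ℕ → σ} {q q' : σ} : q' ∈ reach δ q ↔ ∃ u : List ℕ, wordAct δ u q = q' := by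
  classical
  simp [reach]

/-- `q ∈ reach(q)`. [folklore] -/
theorem self_mem_reach (δ : σ → ℕ → σ) (q : σ) : q ∈ reach δ q :=
  mem_reach.2 ⟨[], rfl⟩

/-- Transitivity of reachability. [folklore] -/
theorem mem_reach_trans {δ : σ → ℕ → σ} {q q' q'' : σ} (h₁ : q' ∈ reach δ q)
    (h₂ : q'' ∈ reach δ q') : q'' ∈ reach δ q := by
  obtain ⟨u, rfl⟩ := mem_reach.1 h₁
  obtain ⟨v, rfl⟩ := mem_reach.1 h₂
  exact mem_reach.2 ⟨u ++ v, wordAct_append δ u v q⟩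

/-- `reach(q') ⊆ reach(q)` for `q' ∈ reach(q)`. [folklore] -/
theorem reach_subset_reach {δ : σ → ℕ → σ} {q q' : σ} (h : q' ∈ reach δ q) :
    reach δ q' ⊆ reach δ q := fun _ h' => mem_reach_trans h h'

/-- `reach(q)` is closed under the transitions. [folklore] -/
theorem wordAct_mem_reach {δ : σ → ℕ → σ} {q q' : σ} (h : q' ∈ reach δ q) (u : List ℕ) :
    wordAct δ u q' ∈ reach δ q :=
  mem_reach_trans h (mem_reach.2 ⟨u, rfl⟩)

/-- The FINAL states: those from which every reachable state leads back (the union of the final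
strongly connected components, Müllner §1.1). [cite: Mullner2017, §1.1 (final component)] -/
def finalStates (δ : σ → ℕ → σ) : Finset σ := by
  classical exact univ.filter fun q => ∀ q' ∈ reach δ q, q ∈ reach δ q'

/-- Membership in `finalStates`. [folklore] -/
theorem mem_finalStates {δ : σ → ℕ → σ} {q : σ} :
    q ∈ finalStates δ ↔ ∀ q' ∈ reach δ q, q ∈ reach δ q' := by
  classical
  simp [finalStates]

/-- **The final states are closed under the transitions.** [cite: Mullner2017, §1.1] -/
theorem wordAct_mem_finalStates {δ : σ → ℕ → σ} {q : σ} (hq : q ∈ finalStates δ) (u : List ℕ) :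
    wordAct δ u q ∈ finalStates δ := by
  rw [mem_finalStates] at hq ⊢
  intro q'' hq''
  have h1 : wordAct δ u q ∈ reach δ q := mem_reach.2 ⟨u, rfl⟩
  exact mem_reach_trans (hq q'' (mem_reach_trans h1 hq'')) h1

/-- One-letter closure of `finalStates`. [folklore] -/
theorem finalStates_closed {δ : σ → ℕ → σ} {q : σ} (hq : q ∈ finalStates δ) (d : ℕ) :
    δ q d ∈ finalStates δ :=
  wordAct_mem_finalStates hq [d]

/-- **Every state reaches a final state** (Müllner §5.1: a path from every state into some final
component): take a reachable state whose reachable set is smallest. [cite: Mullner2017, §5.1] -/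
theorem exists_wordAct_mem_finalStates (δ : σ → ℕ → σ) (q : σ) :
    ∃ u : List ℕ, wordAct δ u q ∈ finalStates δ := by
  obtain ⟨p, hp, hmin⟩ := exists_min_image (reach δ q) (fun p => (reach δ p).card)
    ⟨q, self_mem_reach δ q⟩
  obtain ⟨u, rfl⟩ := mem_reach.1 hp
  refine ⟨u, mem_finalStates.2 fun p' hp' => ?_⟩
  have hsub : reach δ p' ⊆ reach δ (wordAct δ u q) := reach_subset_reach hp'
  have hcard := hmin p' (mem_reach_trans hp hp')
  rw [eq_of_subset_of_card_le hsub hcard]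
  exact self_mem_reach δ _

/-- The component of a final state is strongly connected (as a set). [folklore] -/
theorem mem_reach_of_mem_reach_final {δ : σ → ℕ → σ} {q p p' : σ} (hq : q ∈ finalStates δ)
    (hp : p ∈ reach δ q) (hp' : p' ∈ reach δ q) : p' ∈ reach δ p :=
  mem_reach_trans (mem_finalStates.1 hq p hp) hp'

end Reach

/-! ## Restriction to a closed set of states -/

section Restrict

variable {σ : Type*}

/-- The automaton restricted to a set of states closed under all letters.
[cite: Mullner2017, §3.1 (the restriction A_i of A to Q'_i)] -/
def restrictδ (δ : σ → ℕ → σ) (C : Finset σ) (hC : ∀ p ∈ C, ∀ d : ℕ, δ p d ∈ C) :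
    ↥C → ℕ → ↥C :=
  fun p d => ⟨δ p d, hC p p.2 d⟩

/-- The restricted automaton acts as the original one. [folklore] -/
theorem coe_wordAct_restrictδ (δ : σ → ℕ → σ) (C : Finset σ)
    (hC : ∀ p ∈ C, ∀ d : ℕ, δ p d ∈ C) (u : List ℕ) (p : ↥C) :
    ((wordAct (restrictδ δ C hC) u p : ↥C) : σ) = wordAct δ u p := by
  induction u generalizing p with
  | nil => rfl
  | cons d u ih => exact ih _

/-- Non-digits keep acting trivially on the restriction. [folklore] -/
theorem restrictδ_digitRestrict_of_le {k : ℕ} (δ : σ → ℕ → σ) (C : Finset σ)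
    (hC : ∀ p ∈ C, ∀ d : ℕ, digitRestrict k δ p d ∈ C) (p : ↥C) {d : ℕ} (hd : k ≤ d) :
    restrictδ (digitRestrict k δ) C hC p d = p :=
  Subtype.ext (digitRestrict_of_le δ p hd)

variable [Fintype σ]

/-- The component `reach δ q` of a state is closed. [folklore] -/
theorem reach_closed (δ : σ → ℕ → σ) (q : σ) : ∀ p ∈ reach δ q, ∀ d : ℕ, δ p d ∈ reach δ q :=
  fun _ hp d => wordAct_mem_reach hp [d]

/-- **The restriction to a final component is strongly connected.**
[cite: Mullner2017, §1.1 (final component)] -/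
theorem isStronglyConnected_restrict_reach {δ : σ → ℕ → σ} {q : σ} (hq : q ∈ finalStates δ) :
    IsStronglyConnected (restrictδ δ (reach δ q) (reach_closed δ q)) := by
  intro p p'
  obtain ⟨u, hu⟩ := mem_reach.1 (mem_reach_of_mem_reach_final hq p.2 p'.2)
  exact ⟨u, Subtype.ext (by rw [coe_wordAct_restrictδ]; exact hu)⟩

end Restrict

/-! ## Transport along equal transducer states; the transducer estimate (Müllner Prop. 3.2) -/

section Estimate

variable {σ : Type*} [Fintype σ] [DecidableEq σ]

/-- Reading a group element back through the enumerations of equal states gives the same state.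
[folklore] -/
theorem MinImage.coe_enum_symm_congr {δ : σ → ℕ → σ} {X Y : MinImage δ} (h : X = Y)
    (j : Fin (minRank δ)) : ((X.enum.symm j : ↥X.1) : σ) = ((Y.enum.symm j : ↥Y.1) : σ) := by
  subst h
  rfl

open scoped ArithmeticFunction.Moebius in
/-- **Müllner's Proposition 3.2, for the regular representation and shift `r = 0`**, as a
property of a strongly connected base-`k` automaton `(σ, δ)`, a state `M` of its naturally
induced transducer, a group element `π`, and digit lengths `λ₁, λ₂`: for every `ε > 0`, for all
large `N` (with `k^{ν−1} ≤ N < k^ν`), uniformly in the prefix `b` (first `λ₁` digits of the padded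
word `(n)_k^ν`) and the residue `m`,
`|∑_{n ≤ N : ⌊n/k^{ν−λ₁}⌋ = b, n ≡ m (k^{λ₂}), T(M, (n mod k^{ν−λ₁})_k^{ν−λ₁}) = π} μ(n)| ≤ ε N`.
Müllner states Prop. 3.2 for every unitary irreducible representation `D` of `G` in Frobenius
norm and uniformly in a shift `r`; the matrix coefficients of the regular representation are the
indicators `[T = π]`, which is all that the reduction Prop. 3.3 uses (for the sequence itself,
`r = 0`). The paper PROVES it (Thms. 4.4, 4.5, Lemma 4.10, §4.3); it is the analytic core
(Mauduit–Rivat method) and is NOT formalised — this definition only names the property so that the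
reduction `Prop. 3.2 ⇒ Thm. 1.2` can be stated. [cite: Mullner2017, Prop. 3.2] -/
def TransducerMoebiusEstimate (k : ℕ) (δ : σ → ℕ → σ) (M : MinImage δ)
    (π : Equiv.Perm (Fin (minRank δ))) (l1 l2 : ℕ) : Prop :=
  ∀ ε : ℝ, 0 < ε → ∃ N₀ : ℕ, ∀ N : ℕ, N₀ ≤ N → ∀ b m : ℕ,
    ‖∑ n ∈ (Finset.range (N + 1)).filter (fun n =>
        n / k ^ ((Nat.digits k N).length - l1) = b ∧ n % k ^ l2 = m ∧
          M.T (msbBlock k ((Nat.digits k N).length - l1)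
            (n % k ^ ((Nat.digits k N).length - l1))) = π),
      (μ n : ℂ)‖ ≤ ε * N

end Estimate

end Literature.NumberTheory.LFunctions
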